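import Summits.MatrixMultiplication.MatrixMultiplication.Theorems.TetrahedronTensor
import Literature.Computability.AlgebraicComplexity.RectangularExponentHomogeneity
import Literature.Computability.AlgebraicComplexity.RectangularExponentAsymptoticRank
import HarnessLib

/-!
# OctahedronTensor — the octahedron graph tensor `T(K_{2,2,2})` is EXACTLY `ω`-priced:
`ω₆(Oct) = 8·ω` at bond `n²` (i.e. `4·ω` per unit bond), over every field

(decomp-mm lens 6 «barrier-complement carving», gen 35; a Theorems kernel beneath the attacked leaf
`TetrahedronCarving.TetraExcessZero` (stmt-26697), filed `--as helper`: structural knowledge for the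
leaf's dossier — it delineates the barrier complement among graph tensors — not a stub of its line.)

THE OBJECT. The octahedron `K_{2,2,2}` (vertices `x₀,x₁ | y₀,y₁ | z₀,z₁`, the three antipodal
classes; 12 edges = all pairs not antipodal; 8 triangular faces `(x_s, y_t, z_u)`, one per sign
vector; every edge lies in exactly 2 faces, every vertex in exactly 4) carries the 6-party graph
tensor (Christandl–Vrana–Zuiddam, arXiv:1609.07476 [CVZ19], Ex. 1.1.2, Prop. 1.1.16, §1.3;
Brand et al., arXiv:2602.11975 [BCKLOSW26], Def. 9, Lemma 12) with one EPR pair of bond `n²` per edge.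
[ChristandlVranaZuiddam2016] [BrandEtAl2026] It is DEFINED here
(`oct`) as the Kronecker product of the eight matrix multiplication tensors `⟨n,n,n⟩` placed on the
faces (graph sum = Kronecker product, BCKLOSW26 Lemma 12: the doubled octahedron `2·K_{2,2,2}` is the
edge-disjoint union of its 8 faces), in the `tensorRankD` format `(Fin 6 → Fin ((n·n)⁴)) → F`: a
leg index is four FACE SLOTS, each a pair of labels `∈ [n]²` (the two edges of that face at that
vertex) — no padding is needed, because `K_{2,2,2}` is 4-regular and every vertex lies in 4 faces.

THE THEOREM (★ `omegaOct_eq`). `ω_oct := inf {β | R₆(oct F n) = O(n^β)} = 8·ω(F)` over EVERY field: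
* cover: `R₆(oct F n) ≤ R(⟨n,n,n⟩)⁸` (`tensorRankD_oct_le`), so `ω_oct ≤ 8ω`;
* grouping the antipodal classes `{x₀,x₁} | {y₀,y₁} | {z₀,z₁}` turns every face into a triangle on
  the SAME three parties with the same orientation, so the grouped octahedron IS `⟨n⁸, n⁸, n⁸⟩`
  (`oct_groupLegs`), whence `R(⟨n⁸,n⁸,n⁸⟩) ≤ R₆(oct F n)` (`tensorRank_matMulTensor_le_tensorRankD_oct`)
  and `ω(8,8,8) = 8ω ≤ ω_oct` (homogeneity, `omegaRect_smul`).
Hence `16 ≤ ω_oct`, and `ω(ℂ) = 2 ⟺ ω_oct(ℂ) ≤ 16` (`matrixMultiplication_iff_octFlat`): octahedron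
flatness is an EQUIVALENT frame of the summit, decided relative to `ω` with zero loss.

WHY UNDER THE LEAF (lens reading; details and the general remark in the memo NODE-g35.md). The same
two-line argument prices EVERY complete tripartite graph tensor by a rectangular exponent:
`ω(T(K_{a,b,c})) = ω(ab, bc, ca) = abc·ω(1/c, 1/a, 1/b)` per unit bond (classes `A,B,C` ↦ parties
`X,Y,Z` of `matMulTensor`: grouping gives `⟨n^{ab}, n^{bc}, n^{ca}⟩`; the `abc` transversal triangles,
each `AB`-bond split among the `c` triangles through it, give `abc` copies of `⟨n^{1/c},n^{1/a},n^{1/b}⟩`;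
equal by homogeneity). Instances: triangle `ω`; diamond `K_{1,1,2} = K₄ - e`: `ω(2,1,2)` (in the tree:
`EdgePencilTriangles.omegaPencil_one_eq_omegaRect_two_one_two`, two singleton classes); book `K_{1,1,c}`:
`c·ω(1,1/c,1)`, flat iff `α ≥ 1/c`; 4-wheel `K_{1,2,2}`: `2·ω(1,1,2)`, flat iff the cell's node
`TwoSaturation` (`ω(1,2,1) = 3`, `Theses/OctaveBudget.lean`); octahedron `K_{2,2,2}` (no singleton
class, `K₄`-free, vertex-transitive): `4ω`, flat iff `ω = 2` (this file). Under `ω = 2` each value is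
the max-cut, so CVZ19 Question 1.3.2 (`ω(T(G)) = f(G)`?; open there beyond bipartite `G`) is, for
complete tripartite `G`, EXACTLY a rectangular matrix multiplication statement; as decomposition
pieces such flatness statements are EQUIV/costume frames of rectangular ones. On four vertices the
only connected graphs with a triangle that are NOT complete tripartite are the paw (= the pendant
model `halfTetra` of `EdgePencilHalfTetra`) and `K₄` (= `tetra`): the two objects of the route — the
minimal candidates for the barrier complement (vertex-count version of the edge-minimality of `K₄`
recorded in `EdgePencilTriangles` §3). Every statement below holds over every field unless marked `ℂ`;
no `sorry`, no new axiom, no instance, no notation, no `Prop`-valued definition.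
-/

noncomputable section
set_option linter.dupNamespace false

open scoped BigOperators
open Filter Asymptotics Literature.Computability.AlgebraicComplexity
open Summit.MatrixMultiplication.MatrixMultiplication.Theorems.TetrahedronTensor

namespace Summit.MatrixMultiplication.MatrixMultiplication.Theorems.OctahedronTensor

/-! ## The octahedron graph tensor `oct F n` (bond `n²` on each of the 12 edges) -/

section Tensor

variable (F : Type*) [Field F]

/-- The `t`-th face slot of a leg index: a pair of labels `∈ [n]²` (the labels, within that face, of
the two edges of the face at this vertex; order as in `matMulTensor`: an `x`-vertex holds
`(xy, xz)`, a `y`-vertex `(xy, yz)`, a `z`-vertex `(yz, xz)`). -/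
def slot {n : ℕ} (x : Fin ((n * n) ^ 4)) (t : Fin 4) : Fin n × Fin n :=
  finProdFinEquiv.symm (finFunctionFinEquiv.symm x t)

/-- **The octahedron graph tensor** `T(K_{2,2,2})` with bond `n²` per edge, as the Kronecker product
of the eight face triangles `⟨n,n,n⟩`. Legs `0,1 = x₀,x₁`, `2,3 = y₀,y₁`, `4,5 = z₀,z₁`; face
number `f = 4s + 2t + u` is `(x_s, y_t, z_u)`; vertex `x_s` stores face `(s,t,u)` in slot `2t + u`,
`y_t` stores it in slot `2s + u`, `z_u` in slot `2s + t`. (CVZ19 Ex. 1.1.2; BCKLOSW26 Def. 9 and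
Lemma 12). -/
def oct (n : ℕ) : (Fin 6 → Fin ((n * n) ^ 4)) → F := fun i =>
  matMulTensor F n n n (slot (i 0) 0) (slot (i 2) 0) (slot (i 4) 0) *
  matMulTensor F n n n (slot (i 0) 1) (slot (i 2) 1) (slot (i 5) 0) *
  matMulTensor F n n n (slot (i 0) 2) (slot (i 3) 0) (slot (i 4) 1) *
  matMulTensor F n n n (slot (i 0) 3) (slot (i 3) 1) (slot (i 5) 1) *
  matMulTensor F n n n (slot (i 1) 0) (slot (i 2) 2) (slot (i 4) 2) *
  matMulTensor F n n n (slot (i 1) 1) (slot (i 2) 3) (slot (i 5) 2) *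
  matMulTensor F n n n (slot (i 1) 2) (slot (i 3) 2) (slot (i 4) 3) *
  matMulTensor F n n n (slot (i 1) 3) (slot (i 3) 3) (slot (i 5) 3)

variable {F}

/-! ## The face cover `R₆(oct F n) ≤ R(⟨n,n,n⟩)⁸` -/

/-- The six legs of the cover summand indexed by `l : Fin 8 → Fin r` (one triad index per face),
from a triad decomposition `⟨n,n,n⟩ = ∑_j w_j ⊗ u_j ⊗ v_j` (`w` on `x`-vertices, `u` on `y`,
`v` on `z`). (CVZ19, Prop. 1.1.16 (proof): covering by triangles). -/
def octLeg {n r : ℕ} (w u v : Fin r → Fin n × Fin n → F) (l : Fin 8 → Fin r) :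
    Fin 6 → Fin ((n * n) ^ 4) → F :=
  ![fun x => w (l 0) (slot x 0) * w (l 1) (slot x 1) * w (l 2) (slot x 2) * w (l 3) (slot x 3),
    fun x => w (l 4) (slot x 0) * w (l 5) (slot x 1) * w (l 6) (slot x 2) * w (l 7) (slot x 3),
    fun x => u (l 0) (slot x 0) * u (l 1) (slot x 1) * u (l 4) (slot x 2) * u (l 5) (slot x 3),
    fun x => u (l 2) (slot x 0) * u (l 3) (slot x 1) * u (l 6) (slot x 2) * u (l 7) (slot x 3),
    fun x => v (l 0) (slot x 0) * v (l 2) (slot x 1) * v (l 4) (slot x 2) * v (l 6) (slot x 3),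
    fun x => v (l 1) (slot x 0) * v (l 3) (slot x 1) * v (l 5) (slot x 2) * v (l 7) (slot x 3)]

/-- **The cover decomposition of the octahedron**: from `⟨n,n,n⟩ = ∑_{j<r} w_j ⊗ u_j ⊗ v_j`,
`oct F n = ∑_{l ∈ [r]^8} ⊗_v octLeg_l(v)` (`r⁸` rank-one terms). (CVZ19, Prop. 1.1.16 (proof);
BCKLOSW26, Lemma 12). -/
theorem oct_eq_sum_cover {n r : ℕ} {w u v : Fin r → Fin n × Fin n → F}
    (hdec : matMulTensor F n n n = ∑ j, triad (w j) (u j) (v j)) :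
    ∑ l : Fin 8 → Fin r, rankOneTensor (octLeg w u v l) = oct F n := by
  classical
  have hMM : ∀ a b c, matMulTensor F n n n a b c = ∑ j : Fin r, w j a * u j b * v j c := by
    intro a b c
    have h := congrFun (congrFun (congrFun hdec a) b) c
    rw [h, Finset.sum_apply, Finset.sum_apply, Finset.sum_apply]
    rfl
  funext i
  -- the eight face terms at the point `i`
  let T : Fin 8 → Fin r → F := ![
    fun j => w j (slot (i 0) 0) * u j (slot (i 2) 0) * v j (slot (i 4) 0),
    fun j => w j (slot (i 0) 1) * u j (slot (i 2) 1) * v j (slot (i 5) 0),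
    fun j => w j (slot (i 0) 2) * u j (slot (i 3) 0) * v j (slot (i 4) 1),
    fun j => w j (slot (i 0) 3) * u j (slot (i 3) 1) * v j (slot (i 5) 1),
    fun j => w j (slot (i 1) 0) * u j (slot (i 2) 2) * v j (slot (i 4) 2),
    fun j => w j (slot (i 1) 1) * u j (slot (i 2) 3) * v j (slot (i 5) 2),
    fun j => w j (slot (i 1) 2) * u j (slot (i 3) 2) * v j (slot (i 4) 3),
    fun j => w j (slot (i 1) 3) * u j (slot (i 3) 3) * v j (slot (i 5) 3)]
  calc (∑ l : Fin 8 → Fin r, rankOneTensor (octLeg w u v l)) i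
      = ∑ l : Fin 8 → Fin r, ∏ t, T t (l t) := by
        rw [Finset.sum_apply]
        refine Finset.sum_congr rfl fun l _ => ?_
        rw [rankOneTensor_apply, Fin.prod_univ_six, Fin.prod_univ_eight]
        simp only [octLeg, T, Matrix.cons_val_zero, Matrix.cons_val_one, Matrix.cons_val_two,
          Matrix.cons_val_three, Matrix.cons_val_four, Matrix.cons_val, Matrix.head_cons,
          Matrix.tail_cons]
        ring
    _ = ∏ t, ∑ j, T t j := (Fintype.prod_sum T).symm
    _ = oct F n i := by
        rw [Fin.prod_univ_eight]
        simp only [oct]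
        rw [hMM, hMM, hMM, hMM, hMM, hMM, hMM, hMM]
        simp only [T, Matrix.cons_val_zero, Matrix.cons_val_one, Matrix.cons_val_two,
          Matrix.cons_val_three, Matrix.cons_val_four, Matrix.cons_val, Matrix.head_cons,
          Matrix.tail_cons]

/-- **Cover bound** `R₆(oct F n) ≤ R(⟨n,n,n⟩)⁸` (rank is sub-multiplicative under the Kronecker
product of the eight face triangles). [cite: ChristandlVranaZuiddam2016, Prop. 1.1.16]
[cite: BrandEtAl2026, Lemma 12] -/
theorem tensorRankD_oct_le (n : ℕ) :
    tensorRankD (oct F n) ≤ tensorRank (matMulTensor F n n n) ^ 8 := by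
  classical
  obtain ⟨w, u, v, hdec⟩ := exists_triad_decomposition_tensorRank (matMulTensor F n n n)
  have hsum := oct_eq_sum_cover hdec
  have hcard : Fintype.card (Fin 8 → Fin (tensorRank (matMulTensor F n n n))) =
      tensorRank (matMulTensor F n n n) ^ 8 := by simp
  rw [← hcard]
  let e := Fintype.equivFin (Fin 8 → Fin (tensorRank (matMulTensor F n n n)))
  refine tensorRankD_le_of_eq_sum (fun k => octLeg w u v (e.symm k)) ?_
  rw [← hsum]
  exact Fintype.sum_equiv e.symm _ _ (fun _ => rfl)

/-- `oct F n` decomposes over rank-one tensors (so `tensorRankD (oct F n)` is a genuine minimum).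
(CVZ19, Ex. 1.1.2). -/
theorem oct_decomposable (n : ℕ) :
    ∃ s : ℕ, ∃ g : Fin s → ((Fin 6 → Fin ((n * n) ^ 4)) → F),
      (∀ k, g k ∈ rankOneTensors F ((n * n) ^ 4) 6) ∧ ∑ k, g k = oct F n := by
  classical
  obtain ⟨w, u, v, hdec⟩ := exists_triad_decomposition_tensorRank (matMulTensor F n n n)
  let e := Fintype.equivFin (Fin 8 → Fin (tensorRank (matMulTensor F n n n)))
  refine ⟨_, fun k => rankOneTensor (octLeg w u v (e.symm k)), fun _ => rankOneTensor_mem _, ?_⟩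
  rw [← oct_eq_sum_cover hdec]
  exact Fintype.sum_equiv e.symm _ _ (fun _ => rfl)

/-- A rank-one decomposition of `oct F n` of length exactly `R₆(oct F n)`. [folklore] -/
theorem exists_rankOne_decomposition_oct (n : ℕ) :
    ∃ u : Fin (tensorRankD (oct F n)) → Fin 6 → Fin ((n * n) ^ 4) → F,
      ∑ k, rankOneTensor (u k) = oct F n := by
  classical
  obtain ⟨g, hg, hs⟩ := sComplexity_spec (oct_decomposable (F := F) n)
  simp only [rankOneTensors, Set.mem_range] at hg
  choose u hu using hg
  have h : ∑ k, rankOneTensor (u k) = ∑ k, g k := Finset.sum_congr rfl fun k _ => hu k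
  exact ⟨u, h.trans hs⟩

end Tensor

/-! ## Grouping the antipodal classes: the grouped octahedron IS `⟨n⁸, n⁸, n⁸⟩` -/

section Grouping

variable {F : Type*} [Field F]

/-- The `f`-th label (one per face) of a grouped index `∈ [n⁸] ≃ ([8] → [n])`. -/
def lab {n : ℕ} (x : Fin (n ^ 8)) (f : Fin 8) : Fin n :=
  finFunctionFinEquiv.symm x f

/-- Two grouped indices agree iff their eight face labels agree. -/
theorem eq_iff_lab {n : ℕ} (x y : Fin (n ^ 8)) :
    x = y ↔ (lab x 0 = lab y 0 ∧ lab x 1 = lab y 1 ∧ lab x 2 = lab y 2 ∧ lab x 3 = lab y 3 ∧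
      lab x 4 = lab y 4 ∧ lab x 5 = lab y 5 ∧ lab x 6 = lab y 6 ∧ lab x 7 = lab y 7) := by
  constructor
  · rintro rfl
    exact ⟨rfl, rfl, rfl, rfl, rfl, rfl, rfl, rfl⟩
  · rintro ⟨h0, h1, h2, h3, h4, h5, h6, h7⟩
    apply finFunctionFinEquiv.symm.injective
    funext f
    fin_cases f
    · exact h0
    · exact h1
    · exact h2
    · exact h3
    · exact h4
    · exact h5
    · exact h6
    · exact h7

/-- The leg index of a vertex that reads the faces `φ 0, …, φ 3` (its four faces, in slot order) off
a grouped point `e = (I, J) ∈ [n⁸]²`: slot `t` holds the pair `(I_{φ t}, J_{φ t})`. -/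
def gleg {n : ℕ} (φ : Fin 4 → Fin 8) (e : Fin (n ^ 8) × Fin (n ^ 8)) : Fin ((n * n) ^ 4) :=
  finFunctionFinEquiv fun t => finProdFinEquiv (lab e.1 (φ t), lab e.2 (φ t))

/-- Decoding a grouped leg. -/
@[simp] theorem slot_gleg {n : ℕ} (φ : Fin 4 → Fin 8) (e : Fin (n ^ 8) × Fin (n ^ 8)) (t : Fin 4) :
    slot (gleg φ e) t = (lab e.1 (φ t), lab e.2 (φ t)) := by
  simp [slot, gleg]

/-- The six legs of `oct F n` read off a point `(a, b, c)` of `⟨n⁸, n⁸, n⁸⟩` under the grouping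
`{x₀,x₁} | {y₀,y₁} | {z₀,z₁}`: `x_s` lies in the faces `4s + (0,1,2,3)`, `y_t` in `2t + (0,1,4,5)`,
`z_u` in `u + (0,2,4,6)` (slot order as in `oct`). -/
def ogroupLegs {n : ℕ} (a b c : Fin (n ^ 8) × Fin (n ^ 8)) : Fin 6 → Fin ((n * n) ^ 4) :=
  ![gleg ![0, 1, 2, 3] a, gleg ![4, 5, 6, 7] a, gleg ![0, 1, 4, 5] b, gleg ![2, 3, 6, 7] b,
    gleg ![0, 2, 4, 6] c, gleg ![1, 3, 5, 7] c]

/-- **The grouped octahedron is `⟨n⁸, n⁸, n⁸⟩`**: at the legs `ogroupLegs a b c`, `oct F n` takes the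
value `⟨n⁸,n⁸,n⁸⟩(a, b, c)` (every face becomes a triangle on the three classes, all with the same
orientation, and the 8 faces exhaust the label positions). Contraction of the three classes, cf.
BCKLOSW26 §3.1; as a rank inequality this is grouping of parties. [folklore] -/
theorem oct_groupLegs {n : ℕ} (a b c : Fin (n ^ 8) × Fin (n ^ 8)) :
    oct F n (ogroupLegs a b c) = matMulTensor F (n ^ 8) (n ^ 8) (n ^ 8) a b c := by
  simp only [oct, matMulTensor, ite_one_zero_mul_ite]
  refine if_congr ?_ rfl rfl
  simp only [ogroupLegs, slot_gleg, Matrix.cons_val_zero, Matrix.cons_val_one, Matrix.cons_val_two,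
    Matrix.cons_val_three, Matrix.cons_val_four, Matrix.cons_val, Matrix.head_cons, Matrix.tail_cons,
    eq_iff_lab a.1 b.1, eq_iff_lab b.2 c.1, eq_iff_lab a.2 c.2]
  tauto

/-- **Grouping lower-bound transfer** `R(⟨n⁸, n⁸, n⁸⟩) ≤ R₆(oct F n)`: a rank-one decomposition
`oct F n = ∑_k ⊗_v u_k(v)` restricts along `ogroupLegs` to a triad decomposition of `⟨n⁸,n⁸,n⁸⟩`
(pairs of antipodal legs multiplied). [folklore] -/
theorem tensorRank_matMulTensor_le_tensorRankD_oct (n : ℕ) :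
    tensorRank (matMulTensor F (n ^ 8) (n ^ 8) (n ^ 8)) ≤ tensorRankD (oct F n) := by
  classical
  obtain ⟨u, hu⟩ := exists_rankOne_decomposition_oct (F := F) n
  refine tensorRank_le_of_eq_sum
    (fun k a => u k 0 (gleg ![0, 1, 2, 3] a) * u k 1 (gleg ![4, 5, 6, 7] a))
    (fun k b => u k 2 (gleg ![0, 1, 4, 5] b) * u k 3 (gleg ![2, 3, 6, 7] b))
    (fun k c => u k 4 (gleg ![0, 2, 4, 6] c) * u k 5 (gleg ![1, 3, 5, 7] c)) ?_
  funext a b c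
  have hpt := congrFun hu (ogroupLegs a b c)
  rw [Finset.sum_apply, oct_groupLegs] at hpt
  rw [← hpt, Finset.sum_apply, Finset.sum_apply, Finset.sum_apply]
  refine Finset.sum_congr rfl fun k _ => ?_
  rw [rankOneTensor_apply, Fin.prod_univ_six, triad_apply]
  simp only [ogroupLegs, Matrix.cons_val_zero, Matrix.cons_val_one, Matrix.cons_val_two,
    Matrix.cons_val_three, Matrix.cons_val_four, Matrix.cons_val, Matrix.head_cons, Matrix.tail_cons]
  ring

/-- **Flattening lower bound** `n¹⁶ ≤ R₆(oct F n)` (`n ≥ 1`): grouping + the flattening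
`k·n ≤ R(⟨k,m,n⟩)` of `⟨n⁸,n⁸,n⁸⟩` (equivalently: the class cut `{x,y} | {z}` of the octahedron
carries `8` EPR pairs of bond `n²`). (CVZ19, §1.2 (eq. (flat))). -/
theorem pow_sixteen_le_tensorRankD_oct (n : ℕ) [NeZero n] :
    n ^ 16 ≤ tensorRankD (oct F n) := by
  calc n ^ 16 = n ^ 8 * n ^ 8 := by ring
    _ ≤ tensorRank (matMulTensor F (n ^ 8) (n ^ 8) (n ^ 8)) := mul_le_tensorRank_matMulTensor F _ _ _
    _ ≤ tensorRankD (oct F n) := tensorRank_matMulTensor_le_tensorRankD_oct n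

end Grouping

/-! ## The exponent layer: `ω_oct = 8·ω` exactly -/

section Exponent

variable (F : Type) [Field F]

/-- Admissible exponents of the octahedron family `n ↦ oct F n` (bond `n²` per edge).
(CVZ19 Def. 1.1.13; BCKLOSW26 §3.2, `ω(G)`). -/
def octAdmissibleExponents : Set ℝ :=
  {β : ℝ | (fun n : ℕ => (tensorRankD (oct F n) : ℝ)) =O[atTop] fun n : ℕ => (n : ℝ) ^ β}

/-- **The octahedron exponent** `ω_oct = inf {β | R₆(oct F n) = O(n^β)}` (at bond `n²`; the exponent
per unit bond, `ω(T(K_{2,2,2}))` of CVZ19/BCKLOSW26, is `ω_oct / 2`). (BCKLOSW26 §3.2). -/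
def omegaOct : ℝ :=
  sInf (octAdmissibleExponents F)

/-- Grouping: admissible for the octahedron ⟹ admissible for `⟨n⁸, n⁸, n⁸⟩`. [folklore] -/
theorem octAdmissibleExponents_subset_rect :
    octAdmissibleExponents F ⊆ rectAdmissibleExponents F 8 8 8 := by
  intro β hβ
  refine IsBigO.trans ?_ hβ
  refine IsBigO.of_bound 1 ?_
  filter_upwards [eventually_ge_atTop 1] with n hn
  rw [one_mul, Real.norm_of_nonneg (Nat.cast_nonneg _), Real.norm_of_nonneg (Nat.cast_nonneg _)]
  have h8 : rectDim n 8 = n ^ 8 := by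
    rw [show (8 : ℝ) = ((8 : ℕ) : ℝ) by norm_num, rectDim_natCast]
  rw [tensorRank_matMulTensor_congr F h8 h8 h8]
  exact_mod_cast tensorRank_matMulTensor_le_tensorRankD_oct (F := F) n

/-- The admissible exponents of the octahedron are bounded below (grouping). -/
theorem octAdmissibleExponents_bddBelow : BddBelow (octAdmissibleExponents F) :=
  (rectAdmissibleExponents_bddBelow F 8 8 8).mono (octAdmissibleExponents_subset_rect F)

/-- **The cover in admissible exponents**: `β` admissible for `⟨n,n,n⟩` ⟹ `8β` admissible for the
octahedron (`R₆(oct F n) ≤ R(⟨n,n,n⟩)⁸`). (CVZ19, Prop. 1.1.16). -/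
theorem mem_octAdmissibleExponents_of_cover {β : ℝ} (hβ : β ∈ admissibleExponents F) :
    8 * β ∈ octAdmissibleExponents F := by
  obtain ⟨C, hC0, hC⟩ := isBigO_iff'.1 hβ
  refine IsBigO.of_bound (C ^ 8) ?_
  filter_upwards [hC] with n hn
  rw [Real.norm_of_nonneg (Nat.cast_nonneg _),
    Real.norm_of_nonneg (Real.rpow_nonneg (Nat.cast_nonneg _) _)] at hn ⊢
  have hn0 : (0 : ℝ) ≤ n := Nat.cast_nonneg _
  have hpow : ((n : ℝ) ^ β) ^ 8 = (n : ℝ) ^ (8 * β) := by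
    rw [← Real.rpow_natCast ((n : ℝ) ^ β) 8, ← Real.rpow_mul hn0]
    congr 1
    push_cast
    ring
  calc (tensorRankD (oct F n) : ℝ)
      ≤ ((tensorRank (matMulTensor F n n n)) ^ 8 : ℕ) := by
        exact_mod_cast tensorRankD_oct_le (F := F) n
    _ = ((tensorRank (matMulTensor F n n n) : ℕ) : ℝ) ^ 8 := by push_cast; ring
    _ ≤ (C * (n : ℝ) ^ β) ^ 8 := pow_le_pow_left₀ (Nat.cast_nonneg _) hn 8
    _ = C ^ 8 * (n : ℝ) ^ (8 * β) := by rw [mul_pow, hpow]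

/-- The admissible exponents of the octahedron are nonempty (cover). -/
theorem octAdmissibleExponents_nonempty : (octAdmissibleExponents F).Nonempty :=
  ⟨8 * 3, mem_octAdmissibleExponents_of_cover F (three_mem_admissibleExponents F)⟩

/-- **Grouping floor in exponents** `ω(8,8,8) ≤ ω_oct`. [folklore] -/
theorem omegaRect_le_omegaOct : omegaRect F 8 8 8 ≤ omegaOct F :=
  csInf_le_csInf (rectAdmissibleExponents_bddBelow F 8 8 8) (octAdmissibleExponents_nonempty F)
    (octAdmissibleExponents_subset_rect F)

/-- **The face cover in exponents** `ω_oct ≤ 8·ω`. [cite: ChristandlVranaZuiddam2016, Prop. 1.1.16] -/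
theorem omegaOct_le_eight_mul_omega : omegaOct F ≤ 8 * omega F := by
  have h : ∀ β ∈ admissibleExponents F, omegaOct F / 8 ≤ β := fun β hβ => by
    have := csInf_le (octAdmissibleExponents_bddBelow F) (mem_octAdmissibleExponents_of_cover F hβ)
    change omegaOct F ≤ 8 * β at this
    linarith
  have h8 : omegaOct F / 8 ≤ omega F := le_csInf (admissibleExponents_nonempty F) h
  linarith

/-- Homogeneity: `ω(8,8,8) = 8·ω`. (Lotti–Romani 1983; tree `omegaRect_smul`, `omegaRect_one_one_one`). -/
theorem omegaRect_eight_eq : omegaRect F 8 8 8 = 8 * omega F := by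
  have h := omegaRect_smul F (t := 8) (by norm_num) (a := 1) (b := 1) (c := 1)
    zero_le_one zero_le_one zero_le_one
  push_cast at h
  rw [mul_one, omegaRect_one_one_one] at h
  exact h

/-- ★ **The octahedron graph tensor is exactly `ω`-priced**: `ω_oct = 8·ω` over every field
(`4·ω` per unit bond: `ω(T(K_{2,2,2})) = 4ω`). Both bounds are attained by the SAME triple of
parties: grouping the antipodal classes gives `⟨n⁸,n⁸,n⁸⟩` below, the 8 face triangles give `8ω`
above. [folklore] -/
theorem omegaOct_eq : omegaOct F = 8 * omega F :=
  le_antisymm (omegaOct_le_eight_mul_omega F)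
    (((omegaRect_eight_eq F).symm.le).trans (omegaRect_le_omegaOct F))

/-- `16 ≤ ω_oct` (from `2 ≤ ω`; equivalently the class-cut flattening `pow_sixteen_le_tensorRankD_oct`). -/
theorem sixteen_le_omegaOct : 16 ≤ omegaOct F := by
  rw [omegaOct_eq]
  have := omega_two_le F
  linarith

/-- **Octahedron flatness is an equivalent frame of the summit**: `ω(ℂ) = 2 ⟺ ω_oct(ℂ) ≤ 16`
(the octahedron graph tensor at bond `n²` has exponent `16`, its flattening value). As a decomposition
piece this is EQUIV (costume), like every complete-tripartite graph tensor flatness statement.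
[cite: ChristandlVranaZuiddam2016, Question 1.3.2] -/
theorem matrixMultiplication_iff_octFlat : _root_.MatrixMultiplication ↔ omegaOct ℂ ≤ 16 := by
  rw [_root_.MatrixMultiplication_iff, omegaOct_eq]
  constructor
  · intro h
    rw [h]
    norm_num
  · intro h
    exact le_antisymm (by linarith) (omega_two_le ℂ)

/-- Under `ω(ℂ) = 2` the octahedron exponent is its flattening value `16` (CVZ19 Question 1.3.2 holds
for `K_{2,2,2}` at `ω = 2`). (CVZ19, §1.3). -/
theorem omegaOct_complex_eq_sixteen_of_matrixMultiplication (hS : _root_.MatrixMultiplication) :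
    omegaOct ℂ = 16 :=
  le_antisymm (matrixMultiplication_iff_octFlat.1 hS) (sixteen_le_omegaOct ℂ)

end Exponent

end Summit.MatrixMultiplication.MatrixMultiplication.Theorems.OctahedronTensor

end
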